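import Summits.ResolutionOfSingularities.ResolutionOfSingularities.Theorems.EquisingularLiftEquisingularLiftNatDirectionChartData
import Literature.AlgebraicGeometry.Modules.FrameTransition
import Mathlib.LinearAlgebra.Matrix.NonsingularInverse
import HarnessLib

/-!
# [OURS · L1 W4.5(b) · S6 (L) brick C2, (★) bridge piece Σ2] The transition matrix of the DICT-adapted frames of `F = g^*ε^*𝒞_{V(I)}`

Cell `res-hironaka`, LADDER-RESOLUTION rung L (D-0089), slot W4.5(b), crux chain w45b: working crux
`Theses.EquisingularLift.EquisingularLiftNat` (stmt-ResolutionOfSingularities-20038) / child `EquisingularLiftNatThree`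
(stmt-ResolutionOfSingularities-20148); brick C2 of res-L1-w45b-stub-4's `Tower.hLift_of_bricks` (socket `stub_elnat_three_liftSections`),
keystone (★) `cechPic_pullback_detClass_conormal_section` of res-type-027, bridge piece **Σ2** of its second cut
(`L/res-type-027/Bridge-pieces2.sig.lean` 5762fafcbd00006d), dealt BY SIGNATURE to res-L1-w45b-stub-2 g9 (desk STATUS l.77834).
`--supports stmt-ResolutionOfSingularities-20148 --as helper`. OURS; NOT a statement of any manuscript; AI-written, and AI review is weaker
than expert review. No `sorry`, standard axioms, DEF-FREE.

WHAT. In (★) the rank-2 bundle `F = g^*ε^*𝒞_{V(I)}` on `Y'` is framed near `p` by `f^p := ψ'♯(A^p) · fx^p` (`fx^p` = the doubly pulled-back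
conormal frame of C1c's chart data `(V_p, x^p, s^p)`, `A^p ∈ GL₂(Γ(G₀, W_p))` = X1's matrix, `ψ' = ψ ≫ ι_Ī`). With `x^q = N x^p` on an
`X₀`-affine `V″` (051 `exists_changeOfGenerators`) and `W″ ⊆ W_p ∩ W_q ∩ j₀⁻¹V″`:
* `sum_smul_sum_smul_eq` — `Σ_j a_j • Σ_l b_{jl} • u_l = Σ_l (Σ_j a_j b_{jl}) • u_l` (bookkeeping);
* `appLE_congr_hom` — `Scheme.Hom.appLE` along equal morphisms;
* **`transition_dictFrame_eq`** (027's signature VERBATIM) — on `V' ⊆ U_p ∩ U_q ∩ ψ'⁻¹W″` the transition matrix of `f^p`, `f^q` is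
  `ψ'♯(A^q| · j₀♯N · (A^p|)⁻¹)`: `T(f^p, f^q)(V')_{r i} = ψ'♯((A^q|·(j₀♯N)·(A^p|)⁻¹)_{i r})`. Proof: `f^q_i| = Σ_j ψ'♯(A^q_{ij})·fx^q_j|`;
  `fx^q_j| = Σ_l (g♯ε♯ι♯N_{jl})·fx^p_l|` (051 `map_basisSection_eq_sum_of_changeOfGenerators`) with `g♯ε♯ι♯ = ψ'♯j₀♯` (`hψ`);
  `fx^p_l| = Σ_r ψ'♯((A^p|)⁻¹_{lr})·f^p_r|` (invert `f^p = ψ'♯(A^p)·fx^p`, Mathlib `Matrix.nonsing_inv`); read the coordinate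
  (`coord_sum_smul_basisSection`).

References (index only): R. Hartshorne, *Algebraic Geometry* (1977), II §5 p. 109–110 (change of basis, `f^*` of a free module) [cite: Hartshorne1977].
-/

noncomputable section

-- `TopCat.Presheaf`/`Scheme.Modules` are not reducible (as in Mathlib's `AlgebraicGeometry/Modules`).
set_option backward.isDefEq.respectTransparency false

open CategoryTheory CategoryTheory.Limits AlgebraicGeometry Opposite TopologicalSpace
open Literature.AlgebraicGeometry.Modules Literature.AlgebraicGeometry.Morphisms
open Literature.AlgebraicGeometry.Deformation Literature.AlgebraicGeometry.Motives
open Literature.AlgebraicGeometry.HodgeTheory Literature.AlgebraicGeometry.Resolution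
open AlgebraicGeometry.Scheme.IdealSheafData
open Summit.ResolutionOfSingularities.ResolutionOfSingularities.Cruxes.EquisingularLiftNat.P1VB

set_option linter.dupNamespace false -- mandated namespace `Summit.<Summit>.<Problem>` of this single-conjunct summit

namespace Summit.ResolutionOfSingularities.ResolutionOfSingularities.Cruxes.EquisingularLiftNat.Sections

/-- Bookkeeping: `Σ_j a_j • Σ_l b_{jl} • u_l = Σ_l (Σ_j a_j b_{jl}) • u_l`. [folklore] -/
theorem sum_smul_sum_smul_eq {R M : Type*} [Semiring R] [AddCommMonoid M] [Module R M] {m n : Type*} [Fintype m] [Fintype n]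
    (a : m → R) (b : m → n → R) (u : n → M) :
    ∑ j, a j • ∑ l, b j l • u l = ∑ l, (∑ j, a j * b j l) • u l := by
  simp_rw [Finset.smul_sum, smul_smul, Finset.sum_smul]
  rw [Finset.sum_comm]

/-- `Scheme.Hom.appLE` along equal morphisms. [folklore] -/
theorem appLE_congr_hom {X Y : Scheme.{0}} {f f' : X ⟶ Y} (h : f = f') (U : Y.Opens) (V : X.Opens) (e : V ≤ f ⁻¹ᵁ U)
    (e' : V ≤ f' ⁻¹ᵁ U) (a : Γ(Y, U)) : f.appLE U V e a = f'.appLE U V e' a := by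
  subst h; rfl

set_option maxHeartbeats 400000 in
/-- **Σ2 — the transition matrix of the DICT-adapted frames of `F = g^*ε^*𝒞_{V(I)}`.** Frames `fp`, `fq` of `F` on `U″_p`, `U″_q` with basis sections
`Σ_j ψ'♯(A^p_{ij}) · (g^*ε^*e_{V_p})_j|` (X4 output shape over 051's doubly pulled-back conormal frames `pullbackFrame g (pullbackFrame ε e)`); on
`V' ⊆ U″_p ∩ U″_q ∩ ψ'⁻¹W″` the transition matrix is `ψ'♯(A^q · j₀♯N · (A^p)⁻¹)` (transposed index convention of `transition`: entry `(r, i)` =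
`r`-th coordinate in `fp` of the `i`-th vector of `fq`). [cite: Hartshorne1977, II §5 pp. 109–110 (change of basis; inverse image of a free module)] -/
theorem transition_dictFrame_eq {X₀ G₀ Y Y' : Scheme.{0}} (j₀ : G₀ ⟶ X₀) (I : X₀.IdealSheafData)
    (ε : Y ⟶ I.subscheme) (g : Y' ⟶ Y) (Ī : G₀.IdealSheafData) (ψ : Y' ⟶ Ī.subscheme) (hψ : ψ ≫ Ī.subschemeι ≫ j₀ = g ≫ ε ≫ I.subschemeι)
    (Vp Vq V'' : X₀.affineOpens) (hVp : (V'' : X₀.Opens) ≤ Vp) (hVq : (V'' : X₀.Opens) ≤ Vq)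
    (xp : Fin 2 → Γ(X₀, (Vp : X₀.Opens))) (xq : Fin 2 → Γ(X₀, (Vq : X₀.Opens)))
    (sp : Fin 2 → Γ(idealModule I.subschemeι, (Vp : X₀.Opens))) (sq : Fin 2 → Γ(idealModule I.subschemeι, (Vq : X₀.Opens)))
    (hsp : ∀ j, toRing (idealModuleι I.subschemeι) (Vp : X₀.Opens) (sp j) = xp j)
    (hsq : ∀ j, toRing (idealModuleι I.subschemeι) (Vq : X₀.Opens) (sq j) = xq j)
    (ep : SheafOfModules.free (Fin 2) ≅ (conormalSheaf I.subschemeι).over (I.subschemeι ⁻¹ᵁ (Vp : X₀.Opens)))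
    (eq' : SheafOfModules.free (Fin 2) ≅ (conormalSheaf I.subschemeι).over (I.subschemeι ⁻¹ᵁ (Vq : X₀.Opens)))
    (hep : ∀ j, basisSection ep j = unitSectionLE I.subschemeι (idealModule I.subschemeι) (le_refl _) (sp j))
    (heq : ∀ j, basisSection eq' j = unitSectionLE I.subschemeι (idealModule I.subschemeι) (le_refl _) (sq j))
    (N : Matrix (Fin 2) (Fin 2) Γ(X₀, (V'' : X₀.Opens)))
    (hN : ∀ j, X₀.presheaf.map (homOfLE hVq).op (xq j) = ∑ l, N j l * X₀.presheaf.map (homOfLE hVp).op (xp l))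
    (Wp Wq W'' : G₀.affineOpens) (hp'' : (W'' : G₀.Opens) ≤ Wp) (hq'' : (W'' : G₀.Opens) ≤ Wq) (hWV'' : (W'' : G₀.Opens) ≤ j₀ ⁻¹ᵁ (V'' : X₀.Opens))
    (Ap : Matrix (Fin 2) (Fin 2) Γ(G₀, (Wp : G₀.Opens))) (Aq : Matrix (Fin 2) (Fin 2) Γ(G₀, (Wq : G₀.Opens))) (hAp : IsUnit Ap.det)
    (Up Uq : Y'.Opens) (hUp : Up ≤ g ⁻¹ᵁ (ε ⁻¹ᵁ (I.subschemeι ⁻¹ᵁ (Vp : X₀.Opens)))) (hUq : Uq ≤ g ⁻¹ᵁ (ε ⁻¹ᵁ (I.subschemeι ⁻¹ᵁ (Vq : X₀.Opens))))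
    (hUWp : Up ≤ (ψ ≫ Ī.subschemeι) ⁻¹ᵁ (Wp : G₀.Opens)) (hUWq : Uq ≤ (ψ ≫ Ī.subschemeι) ⁻¹ᵁ (Wq : G₀.Opens))
    (fp : SheafOfModules.free (Fin 2) ≅
      ((Scheme.Modules.pullback g).obj ((Scheme.Modules.pullback ε).obj (conormalSheaf I.subschemeι))).over Up)
    (fq : SheafOfModules.free (Fin 2) ≅
      ((Scheme.Modules.pullback g).obj ((Scheme.Modules.pullback ε).obj (conormalSheaf I.subschemeι))).over Uq)
    (hfp : ∀ i, basisSection fp i = ∑ j, (ψ ≫ Ī.subschemeι).appLE (Wp : G₀.Opens) Up hUWp (Ap i j) •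
      ((Scheme.Modules.pullback g).obj ((Scheme.Modules.pullback ε).obj (conormalSheaf I.subschemeι))).presheaf.map (homOfLE hUp).op
        (basisSection (E := (Scheme.Modules.pullback g).obj ((Scheme.Modules.pullback ε).obj (conormalSheaf I.subschemeι)))
          (pullbackFrame g (pullbackFrame ε ep)) j))
    (hfq : ∀ i, basisSection fq i = ∑ j, (ψ ≫ Ī.subschemeι).appLE (Wq : G₀.Opens) Uq hUWq (Aq i j) •
      ((Scheme.Modules.pullback g).obj ((Scheme.Modules.pullback ε).obj (conormalSheaf I.subschemeι))).presheaf.map (homOfLE hUq).op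
        (basisSection (E := (Scheme.Modules.pullback g).obj ((Scheme.Modules.pullback ε).obj (conormalSheaf I.subschemeι)))
          (pullbackFrame g (pullbackFrame ε eq')) j))
    (V' : Y'.Opens) (hV'p : V' ≤ Up) (hV'q : V' ≤ Uq) (hV'W : V' ≤ (ψ ≫ Ī.subschemeι) ⁻¹ᵁ (W'' : G₀.Opens)) (r i : Fin 2) :
    transition fp fq (homOfLE hV'p) (homOfLE hV'q) r i =
      (ψ ≫ Ī.subschemeι).appLE (W'' : G₀.Opens) V' hV'W
        ((Aq.map (G₀.presheaf.map (homOfLE hq'').op).hom * N.map (j₀.appLE (V'' : X₀.Opens) (W'' : G₀.Opens) hWV'').hom *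
          (Ap.map (G₀.presheaf.map (homOfLE hp'').op).hom)⁻¹) i r) := by
  classical
  -- `V'` lies below `g⁻¹ε⁻¹ι⁻¹V″` (through `hψ`)
  have hV'V'' : V' ≤ g ⁻¹ᵁ (ε ⁻¹ᵁ (I.subschemeι ⁻¹ᵁ (V'' : X₀.Opens))) := by
    have h1 : V' ≤ (ψ ≫ Ī.subschemeι) ⁻¹ᵁ (j₀ ⁻¹ᵁ (V'' : X₀.Opens)) := fun y hy => hWV'' (hV'W hy)
    have h2 : ((ψ ≫ Ī.subschemeι) ≫ j₀) ⁻¹ᵁ (V'' : X₀.Opens) = (g ≫ ε ≫ I.subschemeι) ⁻¹ᵁ (V'' : X₀.Opens) := by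
      rw [Category.assoc, hψ]
    exact h1.trans h2.le
  -- the ring map `α' = ψ'♯ : Γ(G₀, W″) → Γ(Y', V')` and the restricted scalars
  have hscal : ∀ (W₀ : G₀.Opens) (U₀ : Y'.Opens) (hUW₀ : U₀ ≤ (ψ ≫ Ī.subschemeι) ⁻¹ᵁ W₀) (h₀ : (W'' : G₀.Opens) ≤ W₀) (hVU₀ : V' ≤ U₀)
      (a : Γ(G₀, W₀)),
      Y'.presheaf.map (homOfLE hVU₀).op ((ψ ≫ Ī.subschemeι).appLE W₀ U₀ hUW₀ a) =
        (ψ ≫ Ī.subschemeι).appLE (W'' : G₀.Opens) V' hV'W (G₀.presheaf.map (homOfLE h₀).op a) := by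
    intro W₀ U₀ hUW₀ h₀ hVU₀ a
    change ((ψ ≫ Ī.subschemeι).appLE W₀ U₀ hUW₀ ≫ Y'.presheaf.map (homOfLE hVU₀).op) a =
      (G₀.presheaf.map (homOfLE h₀).op ≫ (ψ ≫ Ī.subschemeι).appLE (W'' : G₀.Opens) V' hV'W) a
    rw [Scheme.Hom.appLE_map, Scheme.Hom.map_appLE]
  -- the change-of-generators scalars: `(g♯ε♯ι♯ N_{jl})|_{V'} = ψ'♯(j₀♯ N_{jl})|`
  have hν : ∀ a : Γ(X₀, (V'' : X₀.Opens)),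
      Y'.presheaf.map (homOfLE hV'V'').op (g.app _ (ε.app _ (I.subschemeι.app (V'' : X₀.Opens) a))) =
        (ψ ≫ Ī.subschemeι).appLE (W'' : G₀.Opens) V' hV'W (j₀.appLE (V'' : X₀.Opens) (W'' : G₀.Opens) hWV'' a) := by
    intro a
    have h1 : Y'.presheaf.map (homOfLE hV'V'').op (g.app _ (ε.app _ (I.subschemeι.app (V'' : X₀.Opens) a))) =
        (g ≫ ε ≫ I.subschemeι).appLE (V'' : X₀.Opens) V' hV'V'' a := rfl
    have h2 : ((ψ ≫ Ī.subschemeι) ≫ j₀).appLE (V'' : X₀.Opens) V' (fun y hy => hWV'' (hV'W hy)) a =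
        (ψ ≫ Ī.subschemeι).appLE (W'' : G₀.Opens) V' hV'W (j₀.appLE (V'' : X₀.Opens) (W'' : G₀.Opens) hWV'' a) := by
      rw [← Scheme.Hom.appLE_comp_appLE (ψ ≫ Ī.subschemeι) j₀ (V'' : X₀.Opens) (W'' : G₀.Opens) V' hWV'' hV'W]
      rfl
    rw [h1, ← h2]
    exact appLE_congr_hom (by rw [Category.assoc, hψ]) _ _ _ _ a
  -- Step A: the `i`-th vector of `fq` restricted to `V'`, on the doubly pulled-back frame of chart `q`
  have hA : ((Scheme.Modules.pullback g).obj ((Scheme.Modules.pullback ε).obj (conormalSheaf I.subschemeι))).presheaf.map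
        (homOfLE hV'q).op (basisSection fq i) =
      ∑ j, (ψ ≫ Ī.subschemeι).appLE (W'' : G₀.Opens) V' hV'W (G₀.presheaf.map (homOfLE hq'').op (Aq i j)) •
        ((Scheme.Modules.pullback g).obj ((Scheme.Modules.pullback ε).obj (conormalSheaf I.subschemeι))).presheaf.map
          (homOfLE hV'V'' ≫ (Opens.map g.base).map ((Opens.map ε.base).map ((Opens.map I.subschemeι.base).map (homOfLE hVq)))).op
          (basisSection (E := (Scheme.Modules.pullback g).obj ((Scheme.Modules.pullback ε).obj (conormalSheaf I.subschemeι)))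
            (pullbackFrame g (pullbackFrame ε eq')) j) := by
    rw [hfq i, map_sum]
    refine Finset.sum_congr rfl fun j _ => ?_
    rw [Scheme.Modules.map_smul, presheaf_map_map, hscal (Wq : G₀.Opens) Uq hUWq hq'' hV'q (Aq i j),
      Subsingleton.elim (homOfLE hV'q ≫ homOfLE hUq)
        (homOfLE hV'V'' ≫ (Opens.map g.base).map ((Opens.map ε.base).map ((Opens.map I.subschemeι.base).map (homOfLE hVq))))]
  -- Step B: the frame of chart `q` on the frame of chart `p` over `V'` (051's change of generators, restricted to `V'`)
  have hB : ∀ j, ((Scheme.Modules.pullback g).obj ((Scheme.Modules.pullback ε).obj (conormalSheaf I.subschemeι))).presheaf.map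
        (homOfLE hV'V'' ≫ (Opens.map g.base).map ((Opens.map ε.base).map ((Opens.map I.subschemeι.base).map (homOfLE hVq)))).op
        (basisSection (E := (Scheme.Modules.pullback g).obj ((Scheme.Modules.pullback ε).obj (conormalSheaf I.subschemeι)))
          (pullbackFrame g (pullbackFrame ε eq')) j) =
      ∑ l, (ψ ≫ Ī.subschemeι).appLE (W'' : G₀.Opens) V' hV'W (j₀.appLE (V'' : X₀.Opens) (W'' : G₀.Opens) hWV'' (N j l)) •
        ((Scheme.Modules.pullback g).obj ((Scheme.Modules.pullback ε).obj (conormalSheaf I.subschemeι))).presheaf.map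
          (homOfLE hV'p).op
          (((Scheme.Modules.pullback g).obj ((Scheme.Modules.pullback ε).obj (conormalSheaf I.subschemeι))).presheaf.map
            (homOfLE hUp).op
            (basisSection (E := (Scheme.Modules.pullback g).obj ((Scheme.Modules.pullback ε).obj (conormalSheaf I.subschemeι)))
              (pullbackFrame g (pullbackFrame ε ep)) l)) := by
    intro j
    rw [← presheaf_map_map, map_basisSection_eq_sum_of_changeOfGenerators I ε g hVp hVq xp xq sp sq hsp hsq ep eq' hep heq
      (fun j l => N j l) hN j, map_sum]
    refine Finset.sum_congr rfl fun l _ => ?_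
    rw [Scheme.Modules.map_smul, hν, presheaf_map_map, presheaf_map_map,
      Subsingleton.elim (homOfLE hV'V'' ≫ (Opens.map g.base).map ((Opens.map ε.base).map ((Opens.map I.subschemeι.base).map (homOfLE hVp))))
        (homOfLE hV'p ≫ homOfLE hUp)]
  -- Step C: the frame of chart `p` on `fp` over `V'` (invert `fp = ψ'♯(A^p) · fx^p`)
  have hAp' : IsUnit (Ap.map (G₀.presheaf.map (homOfLE hp'').op).hom).det := by
    rw [← RingHom.mapMatrix_apply, ← RingHom.map_det]
    exact hAp.map _
  have hfp' : ∀ r', ((Scheme.Modules.pullback g).obj ((Scheme.Modules.pullback ε).obj (conormalSheaf I.subschemeι))).presheaf.map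
        (homOfLE hV'p).op (basisSection fp r') =
      ∑ m, (ψ ≫ Ī.subschemeι).appLE (W'' : G₀.Opens) V' hV'W ((Ap.map (G₀.presheaf.map (homOfLE hp'').op).hom) r' m) •
        ((Scheme.Modules.pullback g).obj ((Scheme.Modules.pullback ε).obj (conormalSheaf I.subschemeι))).presheaf.map
          (homOfLE hV'p).op
          (((Scheme.Modules.pullback g).obj ((Scheme.Modules.pullback ε).obj (conormalSheaf I.subschemeι))).presheaf.map
            (homOfLE hUp).op
            (basisSection (E := (Scheme.Modules.pullback g).obj ((Scheme.Modules.pullback ε).obj (conormalSheaf I.subschemeι)))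
              (pullbackFrame g (pullbackFrame ε ep)) m)) := by
    intro r'
    rw [hfp r', map_sum]
    refine Finset.sum_congr rfl fun m _ => ?_
    rw [Scheme.Modules.map_smul, hscal (Wp : G₀.Opens) Up hUWp hp'' hV'p (Ap r' m)]
    rfl
  have hC : ∀ l, ((Scheme.Modules.pullback g).obj ((Scheme.Modules.pullback ε).obj (conormalSheaf I.subschemeι))).presheaf.map
          (homOfLE hV'p).op
          (((Scheme.Modules.pullback g).obj ((Scheme.Modules.pullback ε).obj (conormalSheaf I.subschemeι))).presheaf.map
            (homOfLE hUp).op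
            (basisSection (E := (Scheme.Modules.pullback g).obj ((Scheme.Modules.pullback ε).obj (conormalSheaf I.subschemeι)))
              (pullbackFrame g (pullbackFrame ε ep)) l)) =
      ∑ r', (ψ ≫ Ī.subschemeι).appLE (W'' : G₀.Opens) V' hV'W ((Ap.map (G₀.presheaf.map (homOfLE hp'').op).hom)⁻¹ l r') •
        ((Scheme.Modules.pullback g).obj ((Scheme.Modules.pullback ε).obj (conormalSheaf I.subschemeι))).presheaf.map
          (homOfLE hV'p).op (basisSection fp r') := by
    intro l
    simp_rw [hfp']
    rw [sum_smul_sum_smul_eq]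
    have hBA : ∀ m, ∑ r', (ψ ≫ Ī.subschemeι).appLE (W'' : G₀.Opens) V' hV'W ((Ap.map (G₀.presheaf.map (homOfLE hp'').op).hom)⁻¹ l r') *
        (ψ ≫ Ī.subschemeι).appLE (W'' : G₀.Opens) V' hV'W ((Ap.map (G₀.presheaf.map (homOfLE hp'').op).hom) r' m) =
        if l = m then 1 else 0 := by
      intro m
      have h := congrArg (fun M : Matrix (Fin 2) (Fin 2) Γ(G₀, (W'' : G₀.Opens)) =>
        (ψ ≫ Ī.subschemeι).appLE (W'' : G₀.Opens) V' hV'W (M l m)) (Matrix.nonsing_inv_mul _ hAp')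
      simp only [Matrix.mul_apply, map_sum, map_mul, Matrix.one_apply] at h
      rw [h]
      split_ifs <;> simp
    simp_rw [hBA, ite_smul, one_smul, zero_smul, Finset.sum_ite_eq, Finset.mem_univ, if_true]
  -- Step D: assemble and read the coordinate
  rw [transition_apply, hA]
  simp_rw [hB, hC]
  simp_rw [sum_smul_sum_smul_eq]
  rw [coord_sum_smul_basisSection]
  simp only [Matrix.mul_apply, Matrix.map_apply, map_sum, map_mul, Finset.sum_mul, Finset.mul_sum]
  rw [Finset.sum_comm]
  refine Finset.sum_congr rfl fun _ _ => Finset.sum_congr rfl fun _ _ => ?_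
  rw [mul_assoc]
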